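import Mathlib
import Literature.Probability.LatticeModels.CriticalBlockMoments
import Literature.Probability.LatticeModels.CriticalUrsellFourSign
import Literature.MathematicalPhysics.QuantumLattice.LatticeScalarField
import Summits.CriticalPhenomena.Ising3DConformalLimit.Theorems.EnergyNotSigmaSquaredMoebiusLimitExistsLocallyBounded
import HarnessLib

/-!
# Route MarkovRigidity, support item `FieldRealisation` (stmt-CriticalPhenomena-11245):
# the smeared critical Ising field — moments and Gaussian domination

Helper towards clause (b) of `FieldRealisation`.  The approximating laws of the construction are the
laws `P = spinFieldLaw ν Λ δ r` of the smeared spin field `Φ(f) = Σ_{x∈Λ} r δ³ f(δx) σ_x` under a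
probability measure `ν` on `{±1}^{ℤ³}` carrying the critical plus correlations
(`spinCorr ν = plusCorr 3 β_c 0`; such a `ν` exists, `exists_plusMeasure_holds`).  This file computes
and bounds their moments:

* `moment_spinFieldLaw_eq_sum` — `E_P[∏ᵢ ω(fᵢ)] = Σ_{z∈Λⁿ} (∏ᵢ r δ³ fᵢ(δzᵢ)) ⟨∏ᵢ σ_{zᵢ}⟩_{β_c}`;
* `moment_spinFieldLaw_odd` — odd moments vanish (`⟨∏σ⟩_{β_c} = 0` for an odd number of spins);
* `moment_spinFieldLaw_even_le` — NEWMAN'S GAUSSIAN DOMINATION of the even moments,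
  `E_P[ω(f)^{2k}] ≤ (2k)!/(2ᵏk!) · V_{|f|}ᵏ` with the smeared absolute two-point sum
  `V_{|f|} = Σ_{a,b∈Λ} |r δ³ f(δa)| |r δ³ f(δb)| ⟨σ_aσ_b⟩_{β_c}` (pointwise inequality
  `criticalCorr_le_pairingSum` smeared with `sum_prod_mul_pairingSum`);
* `integral_exp_mul_abs_eval_le` — hence `E_P[exp(t|ω(f)|)] ≤ 2 exp(t² V_{|f|}/2)`.

References: Newman, Z. Wahrsch. 33 (1975); Aizenman–Duminil-Copin 2021 §6.3; Glimm–Jaffe 1987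
§6.1.  No definitions are introduced.
-/

noncomputable section

namespace Summit.CriticalPhenomena.Ising3DConformalLimit.MarkovRigidityFieldRealisation

open MeasureTheory Literature.Probability.LatticeModels Literature.MathematicalPhysics.QuantumLattice
open Summit.CriticalPhenomena.Ising3DConformalLimit
open scoped ENNReal Nat

variable {ν : Measure (SpinConfig (Site 3))} [IsProbabilityMeasure ν]

/-! ### Moments of the smeared field -/

/-- The smeared spin field evaluated at a test function, as a finite spin sum with the weights
`c_x = r δ³ f(δx)`: `Φ(f)(σ) = Σ_{x∈Λ} c_x σ_x`. [folklore] -/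
theorem spinField_apply_eq_sum (Λ : Finset (Site 3)) (δ r : ℝ) (σ : SpinConfig (Site 3))
    (f : SchwartzMap (EuclideanSpace ℝ (Fin 3)) ℝ) :
    spinField Λ δ r σ f = ∑ x ∈ Λ, (r * δ ^ 3 * f (δ • siteToE x)) * spinAt x σ := by
  unfold spinField
  rw [finLatticeField_apply]
  refine Finset.sum_congr rfl fun x _ => ?_
  ring

/-- **Moments of the smeared field as smeared critical correlators.**  For `ν` carrying the critical
plus correlations, `E_P[∏ᵢ ω(fᵢ)] = Σ_{z∈Λⁿ} (∏ᵢ r δ³ fᵢ(δzᵢ)) ⟨∏ᵢ σ_{zᵢ}⟩_{β_c}`.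
[cite: GlimmJaffe1987, §6.1] -/
theorem moment_spinFieldLaw_eq_sum
    (hν : ∀ A : Finset (Site 3), spinCorr ν A = plusCorr 3 (criticalBeta 3) 0 A)
    (Λ : Finset (Site 3)) (δ r : ℝ) {n : ℕ} (f : Fin n → SchwartzMap (EuclideanSpace ℝ (Fin 3)) ℝ) :
    moment (spinFieldLaw ν Λ δ r) n f =
      ∑ z ∈ Fintype.piFinset (fun _ : Fin n => Λ),
        (∏ i, r * δ ^ 3 * f i (δ • siteToE (z i))) * criticalCorr 3 n z := by
  classical
  unfold moment spinFieldLaw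
  rw [integral_map (measurable_spinField Λ δ r).aemeasurable]
  swap
  · exact (continuous_finsetProd _ fun i _ => continuous_eval_const (f i)).aestronglyMeasurable
  simp_rw [spinField_apply_eq_sum, Finset.prod_univ_sum]
  rw [integral_finsetSum _ fun z _ => ?_]
  · refine Finset.sum_congr rfl fun z _ => ?_
    simp_rw [Finset.prod_mul_distrib]
    rw [integral_const_mul, criticalCorr_eq_integral_spinMonomial hν]
    rfl
  · refine Integrable.of_bound (C := ∏ i, |r * δ ^ 3 * f i (δ • siteToE (z i))|) ?_ ?_
    · exact (Measurable.aestronglyMeasurable (Finset.measurable_prod _ fun i _ =>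
        (measurable_spinAt _).const_mul _))
    · refine Filter.Eventually.of_forall fun σ => ?_
      rw [Real.norm_eq_abs, Finset.abs_prod]
      refine Finset.prod_le_prod (fun i _ => abs_nonneg _) fun i _ => ?_
      rw [abs_mul, abs_spinAt, mul_one]

/-- Odd moments of the smeared field vanish. [cite: GlimmJaffe1987, §6.1] -/
theorem moment_spinFieldLaw_odd
    (hν : ∀ A : Finset (Site 3), spinCorr ν A = plusCorr 3 (criticalBeta 3) 0 A)
    (Λ : Finset (Site 3)) (δ r : ℝ) {n : ℕ} (hn : Odd n) (f : Fin n → SchwartzMap (EuclideanSpace ℝ (Fin 3)) ℝ) :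
    moment (spinFieldLaw ν Λ δ r) n f = 0 := by
  rw [moment_spinFieldLaw_eq_sum hν]
  refine Finset.sum_eq_zero fun z _ => ?_
  rw [criticalCorr_eq_zero_of_odd le_rfl hn, mul_zero]

/-! ### Gaussian domination of the even moments -/

/-- **Newman's Gaussian domination, smeared.**  For `ν` carrying the critical plus correlations and
every test function `f`,
`E_P[ω(f)^{2k}] ≤ (2k)!/(2ᵏ k!) · (Σ_{a,b∈Λ} |c_a| |c_b| ⟨σ_aσ_b⟩_{β_c})ᵏ`, `c_x = r δ³ f(δx)`.
[cite: AizenmanDuminilCopinAnnals2021, arXiv:1912.07973 §6.3, first display (p. 26)] -/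
theorem moment_spinFieldLaw_even_le
    (hν : ∀ A : Finset (Site 3), spinCorr ν A = plusCorr 3 (criticalBeta 3) 0 A)
    (Λ : Finset (Site 3)) (δ r : ℝ) (k : ℕ) (f : SchwartzMap (EuclideanSpace ℝ (Fin 3)) ℝ) :
    moment (spinFieldLaw ν Λ δ r) (2 * k) (fun _ => f) ≤
      ((2 * k)! : ℝ) / (2 ^ k * k !) *
        (∑ a ∈ Λ, ∑ b ∈ Λ, |r * δ ^ 3 * f (δ • siteToE a)| * |r * δ ^ 3 * f (δ • siteToE b)| *
          criticalCorr 3 2 ![a, b]) ^ k := by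
  classical
  rw [moment_spinFieldLaw_eq_sum hν,
    ← sum_prod_mul_pairingSum Λ (fun a => |r * δ ^ 3 * f (δ • siteToE a)|)
      (fun a b => criticalCorr 3 2 ![a, b]) k]
  refine Finset.sum_le_sum fun z _ => ?_
  calc (∏ i, r * δ ^ 3 * f (δ • siteToE (z i))) * criticalCorr 3 (2 * k) z
      ≤ |(∏ i, r * δ ^ 3 * f (δ • siteToE (z i)))| * criticalCorr 3 (2 * k) z := by
        refine mul_le_mul_of_nonneg_right (le_abs_self _)
          (Theorems.GapForcesFarMerging.Negative.criticalCorr_nonneg' _)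
    _ ≤ (∏ i, |r * δ ^ 3 * f (δ • siteToE (z i))|) *
          pairingSum (fun a b => criticalCorr 3 2 ![a, b]) k z := by
        rw [Finset.abs_prod]
        exact mul_le_mul_of_nonneg_left (MoebiusLimitExistsOnlyInteraction.criticalCorr_le_pairingSum k z)
          (Finset.prod_nonneg fun i _ => abs_nonneg _)

/-! ### Elementary bounds -/

/-- The smeared field is bounded by the `ℓ¹` norm of its weights: `|Φ(f)(σ)| ≤ Σ_{x∈Λ} |c_x|`.
[folklore] -/
theorem abs_spinField_apply_le (Λ : Finset (Site 3)) (δ r : ℝ) (σ : SpinConfig (Site 3))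
    (f : SchwartzMap (EuclideanSpace ℝ (Fin 3)) ℝ) :
    |spinField Λ δ r σ f| ≤ ∑ x ∈ Λ, |r * δ ^ 3 * f (δ • siteToE x)| := by
  rw [spinField_apply_eq_sum]
  refine (Finset.abs_sum_le_sum_abs _ _).trans (le_of_eq (Finset.sum_congr rfl fun x _ => ?_))
  rw [abs_mul, abs_spinAt, mul_one]

/-- Pure moments are integrals of powers: `moment P n (f,…,f) = ∫ ω(f)ⁿ dP`. [folklore] -/
theorem moment_const_eq_integral_pow (P : Measure (FieldConfig (EuclideanSpace ℝ (Fin 3)))) (n : ℕ) (f : SchwartzMap (EuclideanSpace ℝ (Fin 3)) ℝ) :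
    moment P n (fun _ => f) = ∫ ω, (ω f) ^ n ∂P := by
  unfold moment
  simp [Finset.prod_const]

omit [IsProbabilityMeasure ν] in
/-- Integrals of continuous functions of `ω(f)` under the smeared law are spin integrals.
[folklore] -/
theorem integral_spinFieldLaw_comp_eval (Λ : Finset (Site 3)) (δ r : ℝ) (f : SchwartzMap (EuclideanSpace ℝ (Fin 3)) ℝ)
    {F : ℝ → ℂ} (hF : Continuous F) :
    ∫ ω, F (ω f) ∂(spinFieldLaw ν Λ δ r) = ∫ σ, F (spinField Λ δ r σ f) ∂ν := by
  unfold spinFieldLaw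
  exact integral_map (measurable_spinField Λ δ r).aemeasurable
    (hF.measurable.comp (measurable_eval f)).aestronglyMeasurable

omit [IsProbabilityMeasure ν] in
/-- The generating functional of the smeared law as a spin integral:
`S_P(f) = ∫ exp(i Φ(f)(σ)) dν(σ)`. [cite: GlimmJaffe1987, §6.1] -/
theorem genFunctional_spinFieldLaw (Λ : Finset (Site 3)) (δ r : ℝ) (f : SchwartzMap (EuclideanSpace ℝ (Fin 3)) ℝ) :
    genFunctional (spinFieldLaw ν Λ δ r) f =
      ∫ σ, Complex.exp (Complex.I * (spinField Λ δ r σ f : ℂ)) ∂ν := by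
  unfold genFunctional
  exact integral_spinFieldLaw_comp_eval Λ δ r f (F := fun x : ℝ => Complex.exp (Complex.I * (x : ℂ)))
    (Complex.continuous_exp.comp (continuous_const.mul Complex.continuous_ofReal))

end Summit.CriticalPhenomena.Ising3DConformalLimit.MarkovRigidityFieldRealisation

end
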